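import Mathlib
import HarnessLib
import Summits.ValiantsHypothesis.ValiantsHypothesis.Theses.MonotoneRestoration
import Literature.Computability.AlgebraicComplexity.PatternExpressions
import Literature.Computability.AlgebraicComplexity.DiPatternExpressions
import Literature.Computability.AlgebraicComplexity.ValiantClasses
import Literature.Computability.AlgebraicComplexity.ValiantClassesProofs
import Literature.Computability.AlgebraicComplexity.ArithCircuit
import Literature.Computability.AlgebraicComplexity.HomogeneousComponentsComplexity
import Summits.ValiantsHypothesis.ValiantsHypothesis.Theorems.MonotoneRestorationOrbitRestorationLinearVolumeQPDiNarrowTight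
import Summits.ValiantsHypothesis.ValiantsHypothesis.Theorems.MonotoneRestorationOrbitCompressionQPDiClosedOfInvariant
import Summits.ValiantsHypothesis.ValiantsHypothesis.Theorems.MonotoneRestorationOrbitRestorationLinearVolumeQPHomPolyBasics

/-!
# Route MonotoneRestoration — aside `OrbitRestorationLinearVolumeQP` (stmt-ValiantsHypothesis-18294):
# HOMOGENEOUS NORMAL FORM — R1 is equivalent to its restriction to HOMOGENEOUS families

Helper file (`--supports stmt-ValiantsHypothesis-18294`), def-free.  The only open stub of line `birth`
(`stub_lvNarrowSpan`, Dwivedi–Pago–Seppelt Outlook Q3 at quasi-polynomial scale) and its tight one-sorted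
form `LvDiNarrow` (`OrbitRestorationLinearVolumeQPDiNarrow.orbitRestorationLinearVolumeQP_iff_lvDiNarrow`) ask
for a use of the `VP` hypothesis on ONE syntactic object; every structural `VP` tool the line card names
(depth reduction, coefficient extraction) starts from a HOMOGENEOUS polynomial.  This file records that the
reduction to the homogeneous case is free for R1:

* `exists_value_eq_castLE`, `exists_diClose_eq_pad` — padding a one-sorted labelled pattern expression with
  idle labels (`k ≤ K` labels, same closed polynomial for `n ≥ 1`, compensating constant `n^{-(K-k)}`);
  `exists_diClose_eq_finset_sum` — a finite sum of closed one-sorted expressions with `≤ K` labels each is a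
  closed expression with `K` labels;
* `homogeneousComponent_lvExpansion` — the degree-`d` component of a linear-volume expansion
  `Σ_i α_i hom_{E_i,n}` is the sub-expansion over the patterns with `d` edges (`hom_{E,n}` is homogeneous of
  degree `|E|`, `HomPolyBasics.isHomogeneous_homPoly`): the linear-volume class is closed under homogeneous
  components, with the same patterns;
* `isVPFamily_homogeneousComponent` — `VP` is closed under `f ↦ (f_n^{(d_n)})_n` for any degree selector
  `d : ℕ → ℕ` (`complexity_homogeneousComponent_le_sq_mul`, BCS Lemma 21.25);
* ★ `lvDiNarrow_of_homogeneous` — if every HOMOGENEOUS `VP` family of the linear-volume class is eventually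
  di-narrow (closed one-sorted expression with `n^k ≤ 2^((log₂ n + c)^c)` labels), then so is EVERY `VP`
  family of the class.  Proof: the HARDEST-COMPONENT SELECTION — `κ(n,d)` = least label count of a closed
  one-sorted expression for `f_n^{(d)}` (exists for `n ≥ 1`, `OrbitSupport.exists_diClose_of_squareSymmetric`);
  `h_n := f_n^{(d*_n)}` with `d*_n` maximising `κ(n,·)` over `d ≤ deg f_n` is ONE homogeneous `VP` family of
  the class, so the hypothesis bounds `κ(n, d*_n)`, hence all `κ(n,d)`, and `f_n = Σ_d f_n^{(d)}` is a sum
  of `deg f_n + 1` closed expressions padded to the common label budget;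
* ★ `orbitRestorationLinearVolumeQP_iff_homogeneous` — **R1 ⟺ R1 restricted to homogeneous families**
  (through the tight one-sorted currency: `OrbitSupport.qpOrbitFamily_iff_diNarrow` forward on homogeneous
  families, `lvDiNarrow_of_homogeneous`, `orbitRestorationLinearVolumeQP_of_lvDiNarrow` back);
  `orbitRestorationLinearVolumeQP_iff_pure` — and to PURE presentations (`f_n` homogeneous of degree `d_n`,
  every pattern with a non-zero coefficient has exactly `d_n` edges).

Honest label: a normal form (VH-free bookkeeping); `stub_lvNarrowSpan`, R1, the crux `OrbitRestorationQP`
and VP ≠ VNP are NOT moved.  References: Bürgisser–Clausen–Shokrollahi 1997, Lemma 21.25 (homogeneous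
components of circuits); Dawar–Pago–Seppelt 2025 §5, §7; Dwivedi–Pago–Seppelt 2026 eq. (1), Outlook Q3.
-/

noncomputable section

-- `Summit.ValiantsHypothesis.ValiantsHypothesis.…` is the tree's single-conjunct layout (Sub = Summit).
set_option linter.dupNamespace false

namespace Summit.ValiantsHypothesis.ValiantsHypothesis.Theorems.OrbitRestorationLinearVolumeQPHomogeneous

open Literature.Computability.AlgebraicComplexity MvPolynomial
open Literature.Computability.AlgebraicComplexity.DiPatternExpr
open Summit.ValiantsHypothesis.ValiantsHypothesis.Theorems

/-! ### Padding one-sorted expressions with idle labels -/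

/-- Transport of a one-sorted expression with `k` labels to `K ≥ k` labels along `Fin.castLE`: the value
at an assignment `ℓ` of the `K` labels is the value of the original at `ℓ ∘ Fin.castLE`. [folklore] -/
theorem exists_value_eq_castLE {k K : ℕ} (hk : k ≤ K) (n : ℕ) (e : DiPatternExpr ℂ k) :
    ∃ e' : DiPatternExpr ℂ K, ∀ ℓ : Fin K → Fin n, e'.value n ℓ = e.value n (ℓ ∘ Fin.castLE hk) := by
  induction e with
  | edge a b => exact ⟨edge (Fin.castLE hk a) (Fin.castLE hk b), fun ℓ => by simp⟩
  | const c => exact ⟨const c, fun ℓ => by simp⟩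
  | add e₁ e₂ ih₁ ih₂ =>
    obtain ⟨e₁', h₁⟩ := ih₁
    obtain ⟨e₂', h₂⟩ := ih₂
    exact ⟨add e₁' e₂', fun ℓ => by simp [h₁, h₂]⟩
  | mul e₁ e₂ ih₁ ih₂ =>
    obtain ⟨e₁', h₁⟩ := ih₁
    obtain ⟨e₂', h₂⟩ := ih₂
    exact ⟨mul e₁' e₂', fun ℓ => by simp [h₁, h₂]⟩
  | sumLabel a e ih =>
    obtain ⟨e', h⟩ := ih
    refine ⟨sumLabel (Fin.castLE hk a) e', fun ℓ => ?_⟩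
    simp only [value_sumLabel, h]
    refine Finset.sum_congr rfl fun v _ => ?_
    rw [Function.update_comp_eq_of_injective ℓ (Fin.castLE_injective hk) a v]

/-- **Padding**: for `n ≥ 1` and `k ≤ K`, every closed one-sorted expression with `k` labels is a closed
one-sorted expression with `K` labels (the `K - k` idle labels are compensated by the constant
`n^{-(K-k)}`). [folklore] -/
theorem exists_diClose_eq_pad {k K : ℕ} (hk : k ≤ K) {n : ℕ} (hn : 1 ≤ n) (e : DiPatternExpr ℂ k) :
    ∃ e' : DiPatternExpr ℂ K, e'.close n = e.close n := by
  obtain ⟨e', he'⟩ := exists_value_eq_castLE hk n e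
  refine ⟨mul (const (((n : ℂ) ^ (K - k))⁻¹)) e', ?_⟩
  rw [OrbitSupport.diClose_constMul]
  unfold DiPatternExpr.close
  rw [Finset.sum_congr rfl fun ℓ _ => he' ℓ,
    OrbitSupport.sum_comp_castLE hk (fun h : Fin k → Fin n => e.value n h),
    nsmul_eq_mul, ← mul_assoc, ← map_natCast C, ← map_mul, Nat.cast_pow,
    inv_mul_cancel₀ (pow_ne_zero _ (by exact_mod_cast (show n ≠ 0 by omega))), map_one, one_mul]

/-- **Finite sums**: for `n ≥ 1`, a finite sum of polynomials each of which is a closed one-sorted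
expression with at most `K` labels is a closed one-sorted expression with `K` labels. [folklore] -/
theorem exists_diClose_eq_finset_sum {ι : Type*} (s : Finset ι) {n K : ℕ} (hn : 1 ≤ n)
    (p : ι → MvPolynomial (Fin n × Fin n) ℂ)
    (h : ∀ i ∈ s, ∃ (k : ℕ) (e : DiPatternExpr ℂ k), k ≤ K ∧ e.close n = p i) :
    ∃ e : DiPatternExpr ℂ K, e.close n = ∑ i ∈ s, p i := by
  classical
  induction s using Finset.induction_on with
  | empty =>
    refine ⟨const 0, ?_⟩
    unfold DiPatternExpr.close
    simp
  | insert a s ha ih =>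
    obtain ⟨k, e, hk, he⟩ := h a (Finset.mem_insert_self a s)
    obtain ⟨e₁, he₁⟩ := exists_diClose_eq_pad hk hn e
    obtain ⟨e₂, he₂⟩ := ih fun i hi => h i (Finset.mem_insert_of_mem hi)
    exact ⟨add e₁ e₂, by rw [OrbitSupport.diClose_add, he₁, he, he₂, Finset.sum_insert ha]⟩

/-! ### Homogeneous components of the linear-volume class and of `VP` families -/

/-- **The degree-`d` component of a linear-volume expansion** is its sub-expansion over the patterns with
exactly `d` edges: `(Σ_i α_i hom_{E_i,n})^{(d)} = Σ_i [|E_i| = d] α_i hom_{E_i,n}`. [cite: DwivediPagoSeppelt2026, eq. (1)] -/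
theorem homogeneousComponent_lvExpansion {n m : ℕ} (d : ℕ) (a b : Fin m → ℕ)
    (E : (i : Fin m) → Multiset (Fin (a i) × Fin (b i))) (α : Fin m → ℂ) :
    homogeneousComponent d (∑ i : Fin m, C (α i) * homPoly (E i) n ℂ) =
      ∑ i : Fin m, C (if Multiset.card (E i) = d then α i else 0) * homPoly (E i) n ℂ := by
  rw [map_sum]
  refine Finset.sum_congr rfl fun i _ => ?_
  rw [homogeneousComponent_C_mul,
    homogeneousComponent_of_mem
      ((mem_homogeneousSubmodule _ _).2 (HomPolyBasics.isHomogeneous_homPoly (K := ℂ) (E i) n))]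
  by_cases hd : Multiset.card (E i) = d
  · rw [if_pos hd, if_pos hd.symm]
  · rw [if_neg hd, if_neg (Ne.symm hd), map_zero, zero_mul, mul_zero]

/-- **`VP` is closed under homogeneous components**: for any degree selector `d : ℕ → ℕ`, the family
`(f_n^{(d_n)})_n` of a `VP` family is `VP` (degree does not increase; `L(f^{(d)}) ≤ (d+2)² L(f)` for
`d ≤ deg f`, BCS Lemma 21.25, and `f^{(d)} = 0` beyond the degree). [cite: Burgisser2000, Def. 2.4] -/
theorem isVPFamily_homogeneousComponent (f : (n : ℕ) → MvPolynomial (Fin n × Fin n) ℂ)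
    (hf : IsVPFamily f) (d : ℕ → ℕ) :
    IsVPFamily fun n => homogeneousComponent (d n) (f n) := by
  obtain ⟨⟨hvars, hdeg⟩, hcomp⟩ := hf
  refine ⟨⟨hvars, hdeg.mono fun n => ?_⟩, ?_⟩
  · show (homogeneousComponent (d n) (f n)).totalDegree ≤ (f n).totalDegree
    by_cases h : (f n).totalDegree < d n
    · rw [homogeneousComponent_eq_zero _ _ h, totalDegree_zero]
      exact Nat.zero_le _
    · exact (homogeneousComponent_isHomogeneous (d n) (f n)).totalDegree_le.trans (not_lt.1 h)
  · have hb : IsPBounded fun n => ((f n).totalDegree + 2) ^ 2 * complexity (f n) :=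
      IsPBounded.mul_holds (IsPBounded.pow_holds (IsPBounded.add_holds hdeg (IsPBounded.const 2)) 2) hcomp
    refine hb.mono fun n => ?_
    show complexity (homogeneousComponent (d n) (f n)) ≤ ((f n).totalDegree + 2) ^ 2 * complexity (f n)
    by_cases h : (f n).totalDegree < d n
    · rw [homogeneousComponent_eq_zero _ _ h, ← C_0, complexity_C_holds]
      exact Nat.zero_le _
    · calc complexity (homogeneousComponent (d n) (f n))
          ≤ (d n + 2) ^ 2 * complexity (f n) := complexity_homogeneousComponent_le_sq_mul (f n) (d n)
        _ ≤ ((f n).totalDegree + 2) ^ 2 * complexity (f n) :=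
          Nat.mul_le_mul_right _ (Nat.pow_le_pow_left (by omega) 2)

/-! ### The hardest-component selection -/

/-- ★ **One-sorted narrowness reduces to homogeneous families.**  If every HOMOGENEOUS `VP` family of the
linear-volume class is, from some level on, the closed polynomial of a one-sorted labelled pattern
expression with `n^k ≤ 2^((log₂ n + c)^c)` labels, then so is every `VP` family of the class.
[cite: DawarPagoSeppelt2025, §7 (p. 45)] -/
theorem lvDiNarrow_of_homogeneous
    (H : ∀ f : (n : ℕ) → MvPolynomial (Fin n × Fin n) ℂ,
      (∃ d : ℕ → ℕ, ∀ n, (f n).IsHomogeneous (d n)) → IsVPFamily f →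
      (∃ (c : ℕ) (m : ℕ → ℕ) (a b : (n : ℕ) → Fin (m n) → ℕ)
          (E : (n : ℕ) → (i : Fin (m n)) → Multiset (Fin (a n i) × Fin (b n i)))
          (α : (n : ℕ) → Fin (m n) → ℂ),
        (∀ n, m n ≤ (n + 2) ^ c) ∧ (∀ n i, a n i + b n i ≤ c * (n + 1)) ∧
          ∀ n, f n = ∑ i : Fin (m n), C (α n i) * homPoly (E n i) n ℂ) →
      ∃ c n₀ : ℕ, ∀ n : ℕ, n₀ ≤ n → ∃ (k : ℕ) (e : DiPatternExpr ℂ k),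
        n ^ k ≤ 2 ^ ((Nat.log 2 n + c) ^ c) ∧ e.close n = f n)
    (f : (n : ℕ) → MvPolynomial (Fin n × Fin n) ℂ) (hVP : IsVPFamily f)
    (hLV : ∃ (c : ℕ) (m : ℕ → ℕ) (a b : (n : ℕ) → Fin (m n) → ℕ)
        (E : (n : ℕ) → (i : Fin (m n)) → Multiset (Fin (a n i) × Fin (b n i)))
        (α : (n : ℕ) → Fin (m n) → ℂ),
      (∀ n, m n ≤ (n + 2) ^ c) ∧ (∀ n i, a n i + b n i ≤ c * (n + 1)) ∧
        ∀ n, f n = ∑ i : Fin (m n), C (α n i) * homPoly (E n i) n ℂ) :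
    ∃ c n₀ : ℕ, ∀ n : ℕ, n₀ ≤ n → ∃ (k : ℕ) (e : DiPatternExpr ℂ k),
      n ^ k ≤ 2 ^ ((Nat.log 2 n + c) ^ c) ∧ e.close n = f n := by
  classical
  obtain ⟨c, m, a, b, E, α, hm, hab, hf⟩ := hLV
  -- the linear-volume expansion of the components
  have hcompLV : ∀ n d, homogeneousComponent d (f n) =
      ∑ i : Fin (m n), C (if Multiset.card (E n i) = d then α n i else 0) * homPoly (E n i) n ℂ := by
    intro n d
    rw [hf n, homogeneousComponent_lvExpansion]
  -- square symmetry of the components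
  have hsymm : ∀ (n d : ℕ) (σ : Equiv.Perm (Fin n)),
      rename (fun ij : Fin n × Fin n => (σ ij.1, σ ij.2)) (homogeneousComponent d (f n)) =
        homogeneousComponent d (f n) := by
    intro n d σ
    rw [hcompLV, map_sum]
    refine Finset.sum_congr rfl fun i _ => ?_
    rw [map_mul, rename_C, rename_perm_homPoly]
  -- every component at a level `n ≥ 1` is a closed one-sorted expression with some number of labels
  have hex : ∀ n d : ℕ, ∃ K : ℕ, 1 ≤ n → ∃ e : DiPatternExpr ℂ K, e.close n = homogeneousComponent d (f n) := by
    intro n d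
    rcases Nat.eq_zero_or_pos n with hn | hn
    · exact ⟨0, fun h => absurd hn (by omega)⟩
    · obtain ⟨e, he⟩ :=
        OrbitSupport.exists_diClose_of_squareSymmetric hn (homogeneousComponent d (f n)) (hsymm n d)
      exact ⟨_, fun _ => ⟨e, he⟩⟩
  -- `κ n d`: the least such number of labels
  let κ : ℕ → ℕ → ℕ := fun n d => Nat.find (hex n d)
  have hκ_spec : ∀ n d : ℕ, 1 ≤ n →
      ∃ e : DiPatternExpr ℂ (κ n d), e.close n = homogeneousComponent d (f n) :=
    fun n d => Nat.find_spec (hex n d)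
  have hκ_min : ∀ (n d K : ℕ) (e : DiPatternExpr ℂ K),
      e.close n = homogeneousComponent d (f n) → κ n d ≤ K :=
    fun n d K e he => Nat.find_min' (hex n d) fun _ => ⟨e, he⟩
  -- the hardest component per level
  have hmax : ∀ n : ℕ, ∃ d : ℕ, ∀ d' : ℕ, d' ≤ (f n).totalDegree → κ n d' ≤ κ n d := by
    intro n
    obtain ⟨d, -, hd⟩ := Finset.exists_max_image (Finset.range ((f n).totalDegree + 1)) (κ n)
      ⟨0, Finset.mem_range.2 (Nat.succ_pos _)⟩
    exact ⟨d, fun d' hd' => hd d' (Finset.mem_range.2 (Nat.lt_succ_of_le hd'))⟩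
  choose dstar hdstar using hmax
  -- the hardest-component family: homogeneous, `VP`, linear-volume
  obtain ⟨c₁, n₀, hc₁⟩ := H (fun n => homogeneousComponent (dstar n) (f n))
    ⟨dstar, fun n => homogeneousComponent_isHomogeneous (dstar n) (f n)⟩
    (isVPFamily_homogeneousComponent f hVP dstar)
    ⟨c, m, a, b, E, fun n i => if Multiset.card (E n i) = dstar n then α n i else 0, hm, hab,
      fun n => hcompLV n (dstar n)⟩
  refine ⟨c₁, max n₀ 1, fun n hn => ?_⟩
  have hn₁ : 1 ≤ n := le_of_max_le_right hn
  obtain ⟨k, e, hk, he⟩ := hc₁ n (le_of_max_le_left hn)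
  have hK : κ n (dstar n) ≤ k := hκ_min n (dstar n) k e he
  -- all components of `f n`, padded to `κ n (dstar n)` labels, summed
  obtain ⟨e', he'⟩ := exists_diClose_eq_finset_sum (Finset.range ((f n).totalDegree + 1)) hn₁
    (fun d => homogeneousComponent d (f n)) fun d hd =>
      ⟨κ n d, (hκ_spec n d hn₁).choose,
        hdstar n d (Nat.le_of_lt_succ (Finset.mem_range.1 hd)), (hκ_spec n d hn₁).choose_spec⟩
  refine ⟨κ n (dstar n), e', (Nat.pow_le_pow_right hn₁ hK).trans hk, ?_⟩
  rw [he']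
  exact sum_homogeneousComponent (f n)

/-! ### R1 ⟺ R1 on homogeneous families -/

/-- ★ **HOMOGENEOUS NORMAL FORM of the aside.**  `OrbitRestorationLinearVolumeQP` holds if and only if it
holds for HOMOGENEOUS families: every homogeneous `VP` family `f` (i.e. `f_n` homogeneous of some degree
`d_n` for every `n`) that is, level by level, a combination of `≤ (n+2)^c` homomorphism polynomials of
bipartite patterns with `≤ c (n+1)` vertices has square-symmetric circuits of orbit size
`≤ 2^((log₂ n + c')^c')`.  (Forward: restriction.  Backward: orbit circuits ⇒ one-sorted narrowness on
homogeneous families, `OrbitSupport.qpOrbitFamily_iff_diNarrow`; hardest-component selection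
`lvDiNarrow_of_homogeneous`; one-sorted narrowness ⇒ R1, `orbitRestorationLinearVolumeQP_of_lvDiNarrow`.)
[cite: DwivediPagoSeppelt2026, Outlook Q3] -/
theorem orbitRestorationLinearVolumeQP_iff_homogeneous :
    Summit.ValiantsHypothesis.ValiantsHypothesis.Theses.MonotoneRestoration.OrbitRestorationLinearVolumeQP ↔
    ∀ f : (n : ℕ) → MvPolynomial (Fin n × Fin n) ℂ,
      (∃ d : ℕ → ℕ, ∀ n, (f n).IsHomogeneous (d n)) → IsVPFamily f →
      (∃ (c : ℕ) (m : ℕ → ℕ) (a b : (n : ℕ) → Fin (m n) → ℕ)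
          (E : (n : ℕ) → (i : Fin (m n)) → Multiset (Fin (a n i) × Fin (b n i)))
          (α : (n : ℕ) → Fin (m n) → ℂ),
        (∀ n, m n ≤ (n + 2) ^ c) ∧ (∀ n i, a n i + b n i ≤ c * (n + 1)) ∧
          ∀ n, f n = ∑ i : Fin (m n), C (α n i) * homPoly (E n i) n ℂ) →
      ∃ c : ℕ, ∀ n : ℕ, ∃ (G : Type) (_ : Fintype G)
          (C : LabelledArithCircuit ℂ (Fin n × Fin n) Unit G),
        C.IsSymmetric (Equiv.Perm (Fin n)) ∧ C.eval (C.output ()) = f n ∧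
          C.orbitSize (Equiv.Perm (Fin n)) ≤ 2 ^ ((Nat.log 2 n + c) ^ c) := by
  constructor
  · exact fun h f _ hVP hLV => h f hVP hLV
  · intro H
    refine OrbitRestorationLinearVolumeQPDiNarrow.orbitRestorationLinearVolumeQP_of_lvDiNarrow ?_
    intro f hVP hLV
    exact lvDiNarrow_of_homogeneous
      (fun g hhom hgVP hgLV => ((OrbitSupport.qpOrbitFamily_iff_diNarrow g).1 (H g hhom hgVP hgLV)).2)
      f hVP hLV

/-- ★ **PURE NORMAL FORM.**  `OrbitRestorationLinearVolumeQP` holds if and only if it holds for the `VP`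
families presented, level by level, as a combination of `≤ (n+2)^c` homomorphism polynomials of bipartite
patterns with `≤ c (n+1)` vertices in which `f_n` is homogeneous of degree `d_n` and EVERY PATTERN WITH A
NON-ZERO COEFFICIENT HAS EXACTLY `d_n` EDGES (the off-degree part of a linear-volume expansion of a
homogeneous polynomial cancels and may be dropped, `homogeneousComponent_lvExpansion`). [cite: DwivediPagoSeppelt2026, Outlook Q3] -/
theorem orbitRestorationLinearVolumeQP_iff_pure :
    Summit.ValiantsHypothesis.ValiantsHypothesis.Theses.MonotoneRestoration.OrbitRestorationLinearVolumeQP ↔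
    ∀ f : (n : ℕ) → MvPolynomial (Fin n × Fin n) ℂ, IsVPFamily f →
      (∃ (d : ℕ → ℕ) (c : ℕ) (m : ℕ → ℕ) (a b : (n : ℕ) → Fin (m n) → ℕ)
          (E : (n : ℕ) → (i : Fin (m n)) → Multiset (Fin (a n i) × Fin (b n i)))
          (α : (n : ℕ) → Fin (m n) → ℂ),
        (∀ n, (f n).IsHomogeneous (d n)) ∧
        (∀ n, m n ≤ (n + 2) ^ c) ∧ (∀ n i, a n i + b n i ≤ c * (n + 1)) ∧
        (∀ n i, Multiset.card (E n i) ≠ d n → α n i = 0) ∧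
          ∀ n, f n = ∑ i : Fin (m n), C (α n i) * homPoly (E n i) n ℂ) →
      ∃ c : ℕ, ∀ n : ℕ, ∃ (G : Type) (_ : Fintype G)
          (C : LabelledArithCircuit ℂ (Fin n × Fin n) Unit G),
        C.IsSymmetric (Equiv.Perm (Fin n)) ∧ C.eval (C.output ()) = f n ∧
          C.orbitSize (Equiv.Perm (Fin n)) ≤ 2 ^ ((Nat.log 2 n + c) ^ c) := by
  rw [orbitRestorationLinearVolumeQP_iff_homogeneous]
  constructor
  · intro H f hVP hpure
    obtain ⟨d, c, m, a, b, E, α, hhom, hm, hab, -, hf⟩ := hpure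
    exact H f ⟨d, hhom⟩ hVP ⟨c, m, a, b, E, α, hm, hab, hf⟩
  · intro H f hhom hVP hLV
    obtain ⟨d, hd⟩ := hhom
    obtain ⟨c, m, a, b, E, α, hm, hab, hf⟩ := hLV
    refine H f hVP ⟨d, c, m, a, b, E, fun n i => if Multiset.card (E n i) = d n then α n i else 0,
      hd, hm, hab, fun n i hi => if_neg hi, fun n => ?_⟩
    rw [← homogeneousComponent_lvExpansion, ← hf n,
      homogeneousComponent_of_mem ((mem_homogeneousSubmodule _ _).2 (hd n)), if_pos rfl]

end Summit.ValiantsHypothesis.ValiantsHypothesis.Theorems.OrbitRestorationLinearVolumeQPHomogeneous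

end
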